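import Literature.NumberTheory.PAdicHodge.BmaxPlusFrobeniusEigenTeichLog
import HarnessLib

/-!
# `θ((A_max)^{φ=p}) ⊇ p^N·𝒪_{ℂ_F}`: the surjectivity half of the fundamental exact sequence in `A_max`-currency

Topic `Literature/NumberTheory/PAdicHodge`; namespace `Literature.NumberTheory.PAdicHodge`. THEOREMS ONLY (no definition, no named
fact, no instance, no `sorry`). Companion of `BmaxPlusTDivisibilityAllPrimes` (KERNEL: `(A_max)^{φ=p} ∩ ker θ = ℤ_p·t/p`) on Colmez's
`A_max = B_max⁺(F)`:

* ★★ `exists_frobBmaxPlus_eq_and_thetaBmaxPlus_eq_pow_mul` — **for every `c ∈ 𝒪_{ℂ_F}` there are `N` and `Λ ∈ A_max` with `φ(Λ) = p·Λ` and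
  `θ(Λ) = p^N·c`** (`Λ = p·log[x₁]` for a Teichmüller logarithm `log[x₁]` with `θ = p^{N−1}c`, `BdRPlusLogTeich` IMAGE + the `A_max`-lift of
  `BmaxPlusFrobeniusEigenTeichLog`);
* ★★ `exists_frobBmaxPlus_eq_sub_mem_of_thetaBmaxPlus_eq` — **uniqueness up to `ℤ_p·t`**: two eigenvectors with the same `θ` differ, after
  multiplication by `p²`, by `λ·t`, `λ ∈ ℤ_p`.

So `0 → ℚ_p·t → (B_max⁺)^{φ=p} → ℂ_F → 0` is exact (Fontaine, Th. 5.3.7; Colmez's `U`), proved inside the tree without `B_cris`. φ-road of line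
`kato_lever` (crux K★ `stmt-BirchSwinnertonDyer-22226`, memo `Cruxes/StarredOptimalManinUnitFiveSeven/Lines/kato-lever-K2-tdiv-g25.md`).
Infrastructure only: BSD / K★ are not proved by any of this.

## References
* [FontaineAsterisque223III] J.-M. Fontaine, *Le corps des périodes p-adiques*, Astérisque 223 (1994), Exp. III Th. 5.3.7.
* [FontaineOuyang2022] J.-M. Fontaine, Y. Ouyang, *Theory of p-adic Galois representations*, §6.1, Thm. 6.26.
-/

noncomputable section

open WittVector Field ValuativeRel Polynomial Finset
open Literature.AlgebraicGeometry.Resolution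

namespace Literature.NumberTheory.PAdicHodge

open Literature.NumberTheory.GaloisRepresentations
open Literature.NumberTheory.GaloisRepresentations.IsNonarchimedeanLocalField
open GaloisContinuity

variable {F : Type} [Field F] [ValuativeRel F] [TopologicalSpace F] [IsNonarchimedeanLocalField F]
  [CharZero F] {p : ℕ} [Fact p.Prime] [Fact (¬ IsUnit (p : integerC F))]
  [IsAdicComplete (Ideal.span {(p : integerC F)}) (integerC F)]

set_option maxHeartbeats 1600000 in
/-- ★★ **`θ((A_max)^{φ=p}) ⊇ p^N 𝒪_{ℂ_F}`**: for every `c ∈ 𝒪_{ℂ_F}` there are `N ∈ ℕ` and `Λ ∈ A_max = B_max⁺(F)` with `φ(Λ) = p·Λ` and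
`θ(Λ) = p^N·c` — the surjectivity half of the fundamental exact sequence `0 → ℚ_p t → (B_cris⁺)^{φ=p} → ℂ_p → 0`, in `A_max`.
[cite: FontaineAsterisque223III, Exp. III Th. 5.3.7] [cite: FontaineOuyang2022, §6.1] -/
theorem exists_frobBmaxPlus_eq_and_thetaBmaxPlus_eq_pow_mul (hpv : valuation F p < 1) (c : integerC F) :
    ∃ (N : ℕ) (Λ : BmaxPlus F p), frobBmaxPlus F p Λ = (p : BmaxPlus F p) * Λ ∧ thetaBmaxPlus F p Λ = (p : integerC F) ^ N * c := by
  obtain ⟨N, L₁, ⟨x₁, hx₁, hL₁⟩, hθ₁⟩ := exists_isTeichLog_thetaBdR_eq_pow_mul hpv le_rfl (k := 1) ((c : integerC F) : CompletedAlgClosure F)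
  obtain ⟨Λ, LΛ, L', rΛ, hφΛ, -, hpL', hL', hθΛ⟩ := exists_logSum_teichmuller x₁ hx₁ (k := 1) le_rfl
  have h3 : L' - L₁ ∈ Ideal.span {(xiBdR : BDeRhamPlus (integerC F) p) ^ 1} := hL'.teichmuller_unique hL₁
  have hθ' : thetaBdR L' = thetaBdR L₁ := by
    have h := thetaBdR_eq_zero_of_mem_span_xiBdR_pow le_rfl h3
    rwa [map_sub, sub_eq_zero] at h
  refine ⟨N + 1, Λ, hφΛ, Subtype.ext ?_⟩
  rw [← hθΛ, ← hpL', map_mul, map_natCast, hθ', hθ₁, Subring.coe_mul, SubmonoidClass.coe_pow, coe_natCast_integerC, pow_succ]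
  ring

set_option maxHeartbeats 1600000 in
/-- ★★ **Uniqueness up to `ℤ_p·t`**: if `Λ₁, Λ₂ ∈ (A_max)^{φ=p}` have the same `θ`, then `p²·(Λ₁ − Λ₂) = λ·t` for some `λ ∈ ℤ_p` (Fontaine's lemma
applied to the difference). [cite: FontaineAsterisque223III, Exp. III Th. 5.3.7] -/
theorem exists_sq_mul_sub_eq_zpToAinf_mul_tBmax (hF : Function.Surjective (fontaineTheta (integerC F) p)) {Λ₁ Λ₂ : BmaxPlus F p}
    (h₁ : frobBmaxPlus F p Λ₁ = (p : BmaxPlus F p) * Λ₁) (h₂ : frobBmaxPlus F p Λ₂ = (p : BmaxPlus F p) * Λ₂)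
    (hθ : thetaBmaxPlus F p Λ₁ = thetaBmaxPlus F p Λ₂) :
    ∃ lam : ℤ_[p], (p : BmaxPlus F p) ^ 2 * (Λ₁ - Λ₂) = ainfToBmaxPlus F p (zpToAinf lam) * tBmax :=
  exists_sq_mul_eq_zpToAinf_mul_tBmax' hF (by rw [map_sub, h₁, h₂, mul_sub]) (by rw [map_sub, hθ, sub_self])

end Literature.NumberTheory.PAdicHodge

end
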